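import Literature.Probability.RandomPlanarGeometry.HexSAWSurfaceWallRenewalSixStepRigid

/-!
# Near-renewals cost span: the sharp down-step count, the second gap, and the counts at slack two

For the self-avoiding walk on the honeycomb lattice (brick-wall frame) in the half-plane `Y ≤ 0`, the six-step law
`six_mul_visits_le` of `HexSAWSurfaceWallRenewalSixStep` bounds the surface visits `v = visits n ω` of an IRREDUCIBLE
POSITIVE WALL BRIDGE `ω ∈ ipwb n` (`n ≥ 4`) by `6v ≤ n`; it is the sum of the GAP COUNT `2v + 2 ≤ X_n` (some even column in
`(0, X_n]` is never visited) and the CHARGE COUNT `X_n + 4v ≤ n + 2`, and `HexSAWSurfaceWallRenewalSixStepRigid` decides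
the equality case (SLACK ZERO: the hook staircases).  This module sharpens that bookkeeping at the two places where the
next diagonal of the irreducible census needs it, and derives the numerical skeleton of SLACK TWO (`n = 6k + 2`, `v = k`):

* `apply_add_two_mul_card_stepsD_add_four_mul_visits_le` — the SHARP DOWN-STEP COUNT
  `X_n + 2·#down + 4v ≤ n + 4 + 2·#E`, where `E = ((wallTimes n ω).erase n).filter (NearRenewal n ω ·)` is the set of
  interior visit times that are NEAR-RENEWALS (`NearRenewal`: the walk steps right from `(X_t, 0)`, every earlier
  column is `≤ X_t − 1`, every later one `≥ X_t`); the tree's `apply_add_card_stepsD_add_four_mul_visits_le` is this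
  inequality rounded off by `2·#E ≤ #down` (`two_mul_card_nearRenewal_le_card_stepsD`).
* `wallTimes_apply_ne_of_dive` — the LOCATED GAP: if the walk arrives at a wall site `(q, 0)` from the left and steps
  down there, the wall site `(q+1, 0)` is never visited (it could only be entered from `(q+2, 0)` and never be left);
  the tree's `exists_gap` is the case of the initial wall run.
* `two_mul_visits_add_four_le_apply_of_nearRenewal` — the SECOND GAP: a near-renewal visit time `4 ≤ t < n` forces
  `X_n ≥ 2v + 4`.  The first dive happens before `t` (else the visit at time `2` would be a wall-renewal time) and
  leaves a located gap `≤ X_t`; the wall run leaving `(X_t, 0)` to the right must end in a dive too, because the walk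
  returns to the column `X_t` at depth `≤ −2` (`exists_deep_return_of_nearRenewal`), and that dive leaves a located gap
  `≥ X_t + 2`; the `v` visit abscissae are distinct even numbers in `(0, X_n]` avoiding both gaps.
* `slack_two_counts` — for `ω ∈ ipwb (6k+2)` with `k` visits (`k ≥ 2`, length symbolic `hm : m = 6 * k + 2`):
  `X ∈ {2k+2, 2k+4}`; `#up = #down ≤ 3`; `X = 2k+4 → #down ≤ 2`; `X = 2k+2 →` every interior near-renewal visit time
  equals `2`; `#E ≤ 1`; and `#E = 1` if `#down = 3` or (`X = 2k+4` and `#down = 2`).  With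
  `two_le_card_stepsD_of_slack_two` (`#down ≥ 2`, from the profile lemma `apply_eq_sub_two_of_card_stepsD_eq_one`:
  a block with one down and one up step has `X_n = n − 2`) the vertical-step profile at slack two is `D D U U` or
  `D D D U U U`, the latter only with `X = 2k + 2`.
* §4 re-proves under public names the run machinery kept private in `HexSAWSurfaceWallRenewalSixStepRigid` §2
  (`step_horizontal_of_not_mem`, `of_mem_stepsU_coord`, `of_mem_stepsD_coord`, `run_const_velocity` — a horizontal
  run of a self-avoiding walk has constant velocity `±1` —, `apply_one_eq_card_stepsU_sub_card_stepsD`,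
  `isWRen_of_profile`, `visits_eq_div_two_of_wall`, `first_step_eq`), for the slack-two classification built on this
  module.

PROOFS.  §1 is the tree's proof of `six_mul_visits_le` (the injections `t ↦ X_t / 2` of the visit times into
`[1, X_n/2]` minus the gap, and `t ↦ (t − 2, t − 1)` of the interior visit times into pairs of a left step and a down
step or second left step, `exists_left_step_onto`, `exists_left_step_onto_pred`) with the near-renewal set carried to
the end instead of being paid off.  §2: the located gap is two applications of `step_into_wall_horizontal` /
`wall_steps_horizontal` and injectivity; the second gap finds the two dives as the first non-conforming times of the
two wall runs (`Nat.find`), reads the down steps off `brickWallGraph_adj_coord` (a right step would conform, a left step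
would revisit, an up step would leave the half-plane), and bounds `#(wallTimes)` by `card_le_card_of_injOn` into
`Icc 1 (X_n/2)` with the two half-gaps erased.  §3 combines the faces of `HexSAWSurfaceWallRenewalSixStepRigid` §1 with
§1–§2 by linear arithmetic: `#down = 4` would need `#E ≥ 2`, hence a near-renewal at a time `≥ 4`, hence `X ≥ 2k + 4`,
against `X + #down + 4k ≤ 6k + 6`.  §5 is the tree's `D U` profile argument (three monotone runs, all rightward).

STATUS: lane theorems of the a-idea-1 bridge/renewal lineage (cars 71 `…SixStep`, 73 `…SixStepRigid`, 74a
`…SlackTwoFamilies`); this is the counting half («74b-α») of the slack-two rigidity theorem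
`N_{3k+1,k} = 2 + (k−1)k(2k−1)/6` (lane note FINDING-HEX-WALL-SLACK-TWO-LAW; paper proof PROOF-slack2 §1, §3), whose
constructive half is `HexSAWSurfaceWallRenewalSlackTwoFamilies` and whose classification half is the successor module.
OURS (new in writing, modest): the second-gap lemma and the slack-two counts; checked against the lane's enumeration of
all irreducible positive wall bridges of length `≤ 26` (no near-renewal at a time `≥ 4` with `X_n < 2v + 4`; slack-two
profiles `DDUU`/`DDDUUU` only).  The printed sources carry the renewal / irreducible-bridge structure (Madras–Slade §4.2,
Definition 4.2.1, and the remark before (4.2.21), p. 94, that an irreducible bridge of span `L` has at least `3L` steps;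
Definition 1.2.4; Kesten), the brickwork frame of the honeycomb lattice (Enting–Jensen §7.4.2, Fig. 7.10) and the
surface-visit statistic (Beaton et al. §3.1) — none states these counts.  No `set_option maxHeartbeats` line is used.
-/

namespace Literature.Probability.RandomPlanarGeometry.SAW.HexBW.Wall

open Finset Filter Function
open Literature.Probability.LatticeModels Literature.Probability.Percolation SimpleGraph

variable {n : ℕ} {ω : ℕ → Site 2}

/-- [folklore] Two coordinates determine a site of `ℤ²`. -/
private theorem site_ext_gap {p q : Site 2} (h0 : p 0 = q 0) (h1 : p 1 = q 1) : p = q := by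
  funext k
  fin_cases k
  · exact h0
  · exact h1

/-! ### §1 The sharp down-step count (the six-step bookkeeping with the near-renewal set explicit) -/

open Classical in
/-- The bookkeeping behind the six-step law with the NEAR-RENEWAL set kept explicit (car 71's proof of
`six_mul_visits_le`, not rounded off by `2·#E ≤ #down`): the gap count `2v + 2 ≤ X_n` and the SHARP down-step count
`X_n + 2·#down + 4v ≤ n + 4 + 2·#E`, `E` = the interior visit times that are near-renewals; and `#up = #down`.
[cite: MadrasSlade1993, §4.2, remark before (4.2.21) (p. 94: an irreducible bridge of span L has at least 3L steps)] -/
private theorem six_step_sharp (hω : ω ∈ ipwb n) (hn : 4 ≤ n) :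
    2 * (visits n ω : ℤ) + 2 ≤ ω n 0 ∧
      ω n 0 + 2 * #(stepsD n ω) + 4 * (visits n ω : ℤ) ≤
        n + 4 + 2 * #(((wallTimes n ω).erase n).filter fun t => NearRenewal n ω t) ∧
      #(stepsU n ω) = #(stepsD n ω) := by
  classical
  obtain ⟨hp, hn1, hirr⟩ := mem_ipwb.1 hω
  obtain ⟨hw, hb⟩ := mem_pwb.1 hp
  obtain ⟨ha, -⟩ := mem_wbr.1 hw
  obtain ⟨hh, hn2, hYn⟩ := mem_archs.1 ha
  obtain ⟨hs, hhp⟩ := mem_hpw.1 hh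
  obtain ⟨h0, hend, hbw, hinj⟩ := mem_saws_iff.1 hs
  have hX0 : ω 0 0 = 0 := by rw [h0]; rfl
  have hY0 : ω 0 1 = 0 := by rw [h0]; rfl
  obtain ⟨hcnt, hX, hY⟩ := steps_count hbw
  rw [hX0, sub_zero] at hX
  rw [hY0, hYn, sub_zero] at hY
  obtain ⟨m, hm2, hmL, hme, hmW⟩ := exists_gap hω hn
  have hD1 := one_le_card_stepsD hω hn
  set R := stepsR n ω
  set L := stepsL n ω
  set U := stepsU n ω
  set D := stepsD n ω
  set W := wallTimes n ω with hWdef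
  have hmemW : ∀ {t}, t ∈ W ↔ (1 ≤ t ∧ t ≤ n) ∧ t % 2 = 0 ∧ ω t 1 = 0 := fun {t} => by
    rw [hWdef, wallTimes, Finset.mem_filter, Finset.mem_Icc]
  have hWinj : ∀ {t t'}, t ∈ W → t' ∈ W → ω t 0 = ω t' 0 → t = t' := fun {t t'} ht ht' he => by
    obtain ⟨⟨-, htn⟩, -, hy⟩ := hmemW.1 ht
    obtain ⟨⟨-, htn'⟩, -, hy'⟩ := hmemW.1 ht'
    exact hinj (show t ∈ {i | i ≤ n} from htn) (show t' ∈ {i | i ≤ n} from htn') (site_ext_gap he (by rw [hy, hy']))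
  have hWeven : ∀ {t}, t ∈ W → ω t 0 % 2 = 0 ∧ 0 < ω t 0 ∧ ω t 0 ≤ ω n 0 := fun {t} ht => by
    obtain ⟨⟨ht1, htn⟩, ht2, hy⟩ := hmemW.1 ht
    have hpar := parity_apply hs htn
    rw [hy, add_zero] at hpar
    have hbt := hb t ht1 htn
    rw [hX0] at hbt
    exact ⟨by omega, hbt.1, hbt.2⟩
  -- (1) abscissa count with the gap `m`: `2 · #W + 2 ≤ X_n`
  have hA : 2 * (#W : ℤ) + 2 ≤ ω n 0 := by
    have hmem : m / 2 ∈ Finset.Icc (1 : ℤ) (ω n 0 / 2) := by rw [Finset.mem_Icc]; constructor <;> omega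
    have h1 : #W ≤ #((Finset.Icc (1 : ℤ) (ω n 0 / 2)).erase (m / 2)) := by
      refine Finset.card_le_card_of_injOn (fun t => ω t 0 / 2) (fun t ht => ?_) (fun t ht t' ht' he => ?_)
      · have ht0 := Finset.mem_coe.1 ht
        obtain ⟨he, hpos, hle⟩ := hWeven ht0
        rw [Finset.mem_coe, Finset.mem_erase, Finset.mem_Icc]
        show ω t 0 / 2 ≠ m / 2 ∧ 1 ≤ ω t 0 / 2 ∧ ω t 0 / 2 ≤ ω n 0 / 2
        exact ⟨fun h => hmW t ht0 (by omega), by omega, by omega⟩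
      · obtain ⟨he1, -, -⟩ := hWeven (Finset.mem_coe.1 ht)
        obtain ⟨he2, -, -⟩ := hWeven (Finset.mem_coe.1 ht')
        exact hWinj (Finset.mem_coe.1 ht) (Finset.mem_coe.1 ht') (by dsimp only at he; omega)
    rw [Finset.card_erase_of_mem hmem, Int.card_Icc] at h1
    have h3 := Int.toNat_of_nonneg (show (0 : ℤ) ≤ ω n 0 / 2 + 1 - 1 by omega)
    omega
  -- interior visit times
  have hnW : n ∈ W := hmemW.2 ⟨⟨hn1, le_rfl⟩, hn2, hYn⟩
  set W' := W.erase n with hW'def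
  have hWW' : #W = #W' + 1 := (Finset.card_erase_add_one hnW).symm
  have hmemW' : ∀ {t}, t ∈ W' → 1 ≤ t ∧ t < n ∧ t % 2 = 0 ∧ ω t 1 = 0 ∧ t ∈ W := fun {t} ht => by
    obtain ⟨hne, htW⟩ := Finset.mem_erase.1 ht
    obtain ⟨⟨ht1, htn⟩, ht2, hy⟩ := hmemW.1 htW
    exact ⟨ht1, lt_of_le_of_ne htn hne, ht2, hy, htW⟩
  set E := W'.filter fun t => NearRenewal n ω t with hEdef
  have hEW' : E ⊆ W' := Finset.filter_subset _ _
  have hsd : #(W' \ E) + #E = #W' := Finset.card_sdiff_add_card_eq_card hEW'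
  set Lod := L.filter fun i => ¬ ω (i + 1) 0 % 2 = 0 with hLod
  set Lev := L.filter fun i => ω (i + 1) 0 % 2 = 0 with hLev
  have hLsplit : #Lev + #Lod = #L := Finset.card_filter_add_card_filter_not _
  have hmemL : ∀ {i}, i ∈ L ↔ i < n ∧ ω (i + 1) 0 = ω i 0 - 1 := fun {i} => by
    show i ∈ stepsL n ω ↔ _; rw [stepsL, Finset.mem_filter, Finset.mem_range]
  -- (2a) every interior visit owns a left step landing on its own (even) column
  have hBev : #W' ≤ #Lev := by
    have hex : ∀ t ∈ W', ∃ i, i < n ∧ ω (i + 1) 0 = ω i 0 - 1 ∧ ω (i + 1) 0 = ω t 0 := fun t ht => by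
      obtain ⟨ht1, htn, ht2, hy, -⟩ := hmemW' ht
      obtain ⟨⟨h1 | h1, -⟩, ⟨h0', -⟩, hne⟩ := wall_steps_horizontal hp ht1 htn ht2 hy
      · exact exists_left_step_onto hω ht1 htn ht2 hy h1
      · refine ⟨t - 1, by omega, ?_, ?_⟩
        · rw [show t - 1 + 1 = t by omega]; omega
        · rw [show t - 1 + 1 = t by omega]
    let φ : ℕ → ℕ := fun t => if h : t ∈ W' then Classical.choose (hex t h) else 0
    have hφ : ∀ t (h : t ∈ W'), φ t < n ∧ ω (φ t + 1) 0 = ω (φ t) 0 - 1 ∧ ω (φ t + 1) 0 = ω t 0 := fun t h => by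
      simp only [φ, dif_pos h]; exact Classical.choose_spec (hex t h)
    refine Finset.card_le_card_of_injOn φ (fun t ht => ?_) (fun t ht t' ht' he => ?_)
    · have ht' := Finset.mem_coe.1 ht
      obtain ⟨h1, h2, h3⟩ := hφ t ht'
      have htW := (hmemW' ht').2.2.2.2
      rw [Finset.mem_coe, hLev, Finset.mem_filter, hmemL]
      exact ⟨⟨h1, h2⟩, by rw [h3]; exact (hWeven htW).1⟩
    · have h1 := Finset.mem_coe.1 ht
      have h2 := Finset.mem_coe.1 ht'
      obtain ⟨-, -, e1⟩ := hφ t h1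
      obtain ⟨-, -, e2⟩ := hφ t' h2
      exact hWinj (hmemW' h1).2.2.2.2 (hmemW' h2).2.2.2.2 (by rw [← e1, ← e2, he])
  -- (2b) every interior visit that is not a near-renewal owns a left step landing on the odd column `X_t − 1`
  have hBod : #(W' \ E) ≤ #Lod := by
    have hex : ∀ t ∈ W' \ E, ∃ i, i < n ∧ ω (i + 1) 0 = ω i 0 - 1 ∧ ω (i + 1) 0 = ω t 0 - 1 := fun t ht => by
      rw [Finset.mem_sdiff] at ht
      obtain ⟨ht', htE⟩ := ht
      obtain ⟨ht1, htn, ht2, hy, -⟩ := hmemW' ht'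
      rcases exists_left_step_onto_pred hω ht1 htn ht2 hy with h | h
      · exact h
      · exact absurd (show t ∈ E by rw [hEdef, Finset.mem_filter]; exact ⟨ht', h⟩) htE
    let ψ : ℕ → ℕ := fun t => if h : t ∈ W' \ E then Classical.choose (hex t h) else 0
    have hψ : ∀ t (h : t ∈ W' \ E), ψ t < n ∧ ω (ψ t + 1) 0 = ω (ψ t) 0 - 1 ∧ ω (ψ t + 1) 0 = ω t 0 - 1 :=
      fun t h => by simp only [ψ, dif_pos h]; exact Classical.choose_spec (hex t h)
    have hW'of : ∀ {t}, t ∈ W' \ E → t ∈ W := fun {t} ht => (hmemW' (Finset.mem_sdiff.1 ht).1).2.2.2.2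
    refine Finset.card_le_card_of_injOn ψ (fun t ht => ?_) (fun t ht t' ht' he => ?_)
    · have ht' := Finset.mem_coe.1 ht
      obtain ⟨h1, h2, h3⟩ := hψ t ht'
      have hev := (hWeven (hW'of ht')).1
      rw [Finset.mem_coe, hLod, Finset.mem_filter, hmemL]
      exact ⟨⟨h1, h2⟩, by rw [h3]; omega⟩
    · have h1 := Finset.mem_coe.1 ht
      have h2 := Finset.mem_coe.1 ht'
      obtain ⟨-, -, e1⟩ := hψ t h1
      obtain ⟨-, -, e2⟩ := hψ t' h2
      exact hWinj (hW'of h1) (hW'of h2) (by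
        have : ω t 0 - 1 = ω t' 0 - 1 := by rw [← e1, ← e2, he]
        omega)
  -- conclusion
  rw [visits_eq_card]
  show 2 * ((#W : ℕ) : ℤ) + 2 ≤ ω n 0 ∧
    ω n 0 + 2 * (#D : ℤ) + 4 * ((#W : ℕ) : ℤ) ≤ n + 4 + 2 * (#E : ℤ) ∧ #U = #D
  have hcnt' : ((#R + #L + #U + #D : ℕ) : ℤ) = n := by exact_mod_cast hcnt
  push_cast at hcnt'
  refine ⟨hA, by omega, by omega⟩

open Classical in
/-- **Sharp down-step count.** For an irreducible positive wall bridge of length `n ≥ 4` with `v` visits, `#down` down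
steps and `E` = the set of interior visit times that are NEAR-RENEWALS (`NearRenewal`):
`X_n + 2·#down + 4v ≤ n + 4 + 2·#E`. (The tree's `apply_add_card_stepsD_add_four_mul_visits_le` is this rounded off
by `2·#E ≤ #down`.) NEW, a-idea-1 lineage. [cite: MadrasSlade1993, §4.2, remark before (4.2.21) (p. 94)] -/
theorem apply_add_two_mul_card_stepsD_add_four_mul_visits_le (hω : ω ∈ ipwb n) (hn : 4 ≤ n) :
    ω n 0 + 2 * #(stepsD n ω) + 4 * (visits n ω : ℤ) ≤
      n + 4 + 2 * #(((wallTimes n ω).erase n).filter fun t => NearRenewal n ω t) :=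
  (six_step_sharp hω hn).2.1


/-! ### §2 Located gaps: the even column after a dive is never visited; a near-renewal forces a second gap -/

/-- **Located gap.** If the walk arrives at the wall site `ω i = (q, 0)` from the left (`X_{i−1} = q − 1`) and steps
DOWN there (`Y_{i+1} = −1`), then the even abscissa `q + 1` is never the abscissa of a surface visit: the wall site
`(q+1, 0)` could only be entered from `(q+2, 0)` and could not be left. (The tree's `exists_gap` is the case
of the initial wall run.) [cite: MadrasSlade1993, §4.2, Definition 4.2.1] -/
theorem wallTimes_apply_ne_of_dive (hp : ω ∈ pwb n) {i : ℕ} (hin : i < n) (hYi : ω i 1 = 0)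
    (hX' : ω (i - 1) 0 = ω i 0 - 1) (hD : ω (i + 1) 1 = -1) :
    ∀ t ∈ wallTimes n ω, ω t 0 ≠ ω i 0 + 1 := by
  classical
  obtain ⟨hw, hb⟩ := mem_pwb.1 hp
  obtain ⟨ha, -⟩ := mem_wbr.1 hw
  obtain ⟨hh, hn2, hYn⟩ := mem_archs.1 ha
  obtain ⟨hs, hhp⟩ := mem_hpw.1 hh
  obtain ⟨h0, hend, hbw, hinj⟩ := mem_saws_iff.1 hs
  have hinj' : ∀ {a b}, a ≤ n → b ≤ n → ω a 0 = ω b 0 → ω a 1 = ω b 1 → a = b := fun {a b} ha' hb' h0' h1' =>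
    hinj (show a ∈ {k | k ≤ n} from ha') (show b ∈ {k | k ≤ n} from hb') (site_ext_gap h0' h1')
  have hmemW : ∀ {t}, t ∈ wallTimes n ω ↔ (1 ≤ t ∧ t ≤ n) ∧ t % 2 = 0 ∧ ω t 1 = 0 := fun {t} => by
    rw [wallTimes, Finset.mem_filter, Finset.mem_Icc]
  intro t ht he
  obtain ⟨⟨ht1, htn⟩, ht2, hy⟩ := hmemW.1 ht
  obtain ⟨hx | hx, hy'⟩ := step_into_wall_horizontal hp ht1 htn ht2 hy
  · -- entered from the right: then `t < n` and the walk leaves to `(q, 0) = ω i`, so `t + 1 = i` — but `ω (i-1) ≠ (q+1,0)`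
    have htn' : t < n := by
      rcases lt_or_eq_of_le htn with h | h
      · exact h
      · exfalso; subst h; have := (hb (t - 1) (by omega) (by omega)).2; omega
    obtain ⟨⟨hx1 | hx1, hy1⟩, -, hne⟩ := wall_steps_horizontal hp ht1 htn' ht2 hy
    · exact hne (by rw [hx, hx1])
    · have := hinj' (a := t + 1) (b := i) (by omega) hin.le (by rw [hx1, he]; ring) (by rw [hy1, hYi])
      have ht' : t = i - 1 := by omega
      rw [ht', hX'] at he
      omega
  · -- entered from the left, i.e. from `(q, 0) = ω i`: then `t = i + 1`, but `Y_{i+1} = -1`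
    have := hinj' (a := t - 1) (b := i) (by omega) hin.le (by rw [hx, he]; ring) (by rw [hy', hYi])
    have ht' : t = i + 1 := by omega
    rw [ht'] at hy; rw [hy] at hD; norm_num at hD

/-- **The second gap.** If an irreducible positive wall bridge of length `n` with `v` visits has a near-renewal visit
time `t ≥ 4` (`t < n`), then its span is `X_n ≥ 2v + 4`: besides the located gap after the first dive (an even column
`≤ X_t − 2`), the wall run leaving `(X_t, 0)` to the right ends in a dive of its own (the walk must come back to the
column `X_t` at depth, `exists_deep_return_of_nearRenewal`), whose located gap is an even column `≥ X_t + 2`; the `v`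
visit abscissae are distinct even numbers in `(0, X_n]` avoiding both. NEW, a-idea-1 lineage («second gap lemma»,
PROOF-slack2 §1). [cite: MadrasSlade1993, §4.2, Definition 4.2.1 and remark before (4.2.21) (p. 94)] -/
theorem two_mul_visits_add_four_le_apply_of_nearRenewal (hω : ω ∈ ipwb n) {t : ℕ} (ht : t ∈ wallTimes n ω)
    (htn : t < n) (h4 : 4 ≤ t) (hnr : NearRenewal n ω t) : 2 * (visits n ω : ℤ) + 4 ≤ ω n 0 := by
  classical
  obtain ⟨hp, hn1, hirr⟩ := mem_ipwb.1 hω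
  obtain ⟨hw, hb⟩ := mem_pwb.1 hp
  obtain ⟨ha, -⟩ := mem_wbr.1 hw
  obtain ⟨hh, hn2, hYn⟩ := mem_archs.1 ha
  obtain ⟨hs, hhp⟩ := mem_hpw.1 hh
  obtain ⟨h0, hend, hbw, hinj⟩ := mem_saws_iff.1 hs
  have hX0 : ω 0 0 = 0 := by rw [h0]; rfl
  have hY0 : ω 0 1 = 0 := by rw [h0]; rfl
  have hinj' : ∀ {a b}, a ≤ n → b ≤ n → ω a 0 = ω b 0 → ω a 1 = ω b 1 → a = b := fun {a b} ha' hb' h0' h1' =>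
    hinj (show a ∈ {k | k ≤ n} from ha') (show b ∈ {k | k ≤ n} from hb') (site_ext_gap h0' h1')
  have hmemW : ∀ {t}, t ∈ wallTimes n ω ↔ (1 ≤ t ∧ t ≤ n) ∧ t % 2 = 0 ∧ ω t 1 = 0 := fun {t} => by
    rw [wallTimes, Finset.mem_filter, Finset.mem_Icc]
  obtain ⟨⟨ht1, -⟩, ht2, hYt⟩ := hmemW.1 ht
  obtain ⟨hR, hhead, htail⟩ := hnr
  set x := ω t 0 with hxdef
  -- parity and range facts
  have hWeven : ∀ {t'}, t' ∈ wallTimes n ω → ω t' 0 % 2 = 0 ∧ 0 < ω t' 0 ∧ ω t' 0 ≤ ω n 0 := fun {t'} ht' => by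
    obtain ⟨⟨ht1', htn'⟩, ht2', hy⟩ := hmemW.1 ht'
    have hpar := parity_apply hs htn'
    rw [hy, add_zero] at hpar
    have hbt := hb t' ht1' htn'
    rw [hX0] at hbt
    exact ⟨by omega, hbt.1, hbt.2⟩
  have hWinj : ∀ {a b}, a ∈ wallTimes n ω → b ∈ wallTimes n ω → ω a 0 = ω b 0 → a = b := fun {a b} ha' hb' he => by
    obtain ⟨⟨-, han⟩, -, hya⟩ := hmemW.1 ha'
    obtain ⟨⟨-, hbn⟩, -, hyb⟩ := hmemW.1 hb'
    exact hinj' han hbn he (by rw [hya, hyb])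
  obtain ⟨hxev, hxpos, hxle⟩ := hWeven ht
  have hXnev : ω n 0 % 2 = 0 := by
    have := parity_apply hs le_rfl; rw [hYn, add_zero] at this; omega
  -- the first step is `(0,0) → (1,0)`
  have h1X : ω 1 0 = 1 ∧ ω 1 1 = 0 := by
    have hadj' : brickWallGraph.Adj (ω 0) (ω 1) := hbw 0 (by omega)
    have hadj := (brickWallGraph_adj_coord _ _).1 hadj'
    have hpos := (hb 1 le_rfl (by omega)).1
    have hle := hhp 1 (by omega)
    rw [hX0] at hpos
    rw [hX0, hY0] at hadj
    rcases hadj with ⟨h01, h11⟩ | ⟨h00, ⟨h1a, -⟩ | ⟨h1a, h1b⟩⟩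
    · exact ⟨by omega, by rw [h11]⟩
    · exfalso; omega
    · exfalso; rw [← h00] at h1b; omega
  have hx2 : 2 ≤ x := by have := hhead 1 (by omega); rw [h1X.1] at this; omega
  have hxlt : x + 1 ≤ ω n 0 := by have := (hb (t + 1) (by omega) (by omega)).2; rw [hR] at this; exact this
  -- the deep return after `t`
  obtain ⟨s, hts, hsn, hsx, hsy⟩ := exists_deep_return_of_nearRenewal hω ht1 htn ht2 hYt ⟨hR, hhead, htail⟩
  -- GAP ONE: an even `g₁` with `2 ≤ g₁ ≤ x` which is never a visit abscissa
  obtain ⟨g₁, hg₁2, hg₁x, hg₁e, hg₁W⟩ : ∃ g : ℤ, 2 ≤ g ∧ g ≤ x ∧ g % 2 = 0 ∧ ∀ t' ∈ wallTimes n ω, ω t' 0 ≠ g := by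
    by_cases h2 : ω 2 0 = 2 ∧ ω 2 1 = 0
    · -- the initial wall run `(0,0), …, (a,0)` and its dive at the odd column `a = b - 1`
      have hexQ : ∃ i, i ≤ n ∧ ¬ (ω i 0 = i ∧ ω i 1 = 0) := ⟨s, hsn, fun h => by rw [h.2] at hsy; norm_num at hsy⟩
      obtain ⟨hbn, hbQ⟩ := Nat.find_spec hexQ
      have hQ : ∀ j, j < Nat.find hexQ → ω j 0 = j ∧ ω j 1 = 0 := fun j hj => by
        have := Nat.find_min hexQ hj
        push Not at this
        exact this (by omega)
      set b := Nat.find hexQ with hbdef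
      have hb3 : 3 ≤ b := by
        by_contra hlt
        have h012 : b = 0 ∨ b = 1 ∨ b = 2 := by omega
        rcases h012 with h | h | h <;> rw [h] at hbQ
        · exact hbQ ⟨by rw [hX0]; norm_num, hY0⟩
        · exact hbQ ⟨by rw [h1X.1]; norm_num, h1X.2⟩
        · exact hbQ ⟨by rw [h2.1]; norm_num, h2.2⟩
      obtain ⟨hQa0, hQa1⟩ := hQ (b - 1) (by omega)
      obtain ⟨hQp0, hQp1⟩ := hQ (b - 2) (by omega)
      have hadj := (brickWallGraph_adj_coord _ _).1 (hbw (b - 1) (by omega))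
      rw [show b - 1 + 1 = b by omega] at hadj
      have hbY : ω b 0 = ω (b - 1) 0 ∧ ω b 1 = -1 ∧ (ω (b - 1) 0) % 2 = 1 := by
        rcases hadj with ⟨h01 | h01, h11⟩ | ⟨h00, ⟨h1a, -⟩ | ⟨h1a, h1b⟩⟩
        · exfalso; exact hbQ ⟨by rw [h01, hQa0]; omega, by rw [h11, hQa1]⟩
        · exfalso
          have := hinj' (a := b) (b := b - 2) hbn (by omega) (by rw [hQp0]; omega)
            (by rw [h11, hQa1, hQp1])
          omega
        · exfalso; have := hhp b hbn; rw [hQa1] at h1a; omega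
        · rw [hQa1] at h1a; rw [h00] at h1b
          exact ⟨h00, by omega, by omega⟩
      obtain ⟨hbX, hbY1, hodd⟩ := hbY
      -- the dive happens before `t` (else the visit at time `2` would be a wall-renewal time), so `a ≤ x - 1`
      have hbt : b - 1 < t := by
        by_contra hle
        have htb : t < b := by omega
        obtain ⟨hxt, -⟩ := hQ t htb
        refine hirr 2 (by norm_num) (by omega) ⟨⟨by omega, fun i hi1 hi2 => ?_, fun j hj1 hj2 => ?_⟩, by decide, h2.2⟩
        · rw [hX0, h2.1]
          rcases show i = 1 ∨ i = 2 by omega with h | h <;> subst h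
          · rw [h1X.1]; norm_num
          · rw [h2.1]; norm_num
        · dsimp only
          rw [show (2 : ℕ) + 0 = 2 from rfl, h2.1, show 2 + (n - 2) = n by omega]
          refine ⟨?_, (hb (2 + j) (by omega) (by omega)).2⟩
          by_cases hjb : 2 + j < b
          · rw [(hQ (2 + j) hjb).1]; push_cast; omega
          · have := htail (2 + j) (by omega) (by omega)
            have hx4 : (4 : ℤ) ≤ x := by rw [hxdef, hxt]; exact_mod_cast h4
            omega
      have hax : ω (b - 1) 0 ≤ x - 1 := hhead (b - 1) hbt
      refine ⟨ω (b - 1) 0 + 1, by rw [hQa0]; omega, by omega, by omega, ?_⟩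
      exact wallTimes_apply_ne_of_dive hp (i := b - 1) (by omega) hQa1
        (by rw [show b - 1 - 1 = b - 2 by omega, hQp0, hQa0]; omega) (by rw [show b - 1 + 1 = b by omega, hbY1])
    · -- `(2, 0)` is never visited
      refine ⟨2, le_rfl, by omega, by decide, fun t' ht' he => ?_⟩
      obtain ⟨⟨ht1', htn'⟩, ht2', hy⟩ := hmemW.1 ht'
      have htn'' : t' < n := by
        rcases lt_or_eq_of_le htn' with h | h
        · exact h
        · exfalso
          rw [h] at he
          omega
      obtain ⟨⟨hx1, hy1⟩, ⟨hx0', hy0'⟩, hne⟩ := wall_steps_horizontal hp ht1' htn'' ht2' hy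
      rcases hx0' with hx0' | hx0'
      · have hx1' : ω (t' + 1) 0 = 1 := by omega
        have := hinj' (a := t' + 1) (b := 1) (by omega) (by omega) (by rw [hx1', h1X.1]) (by rw [hy1, h1X.2])
        omega
      · have := hinj' (a := t' - 1) (b := 1) (by omega) (by omega) (by rw [hx0', he, h1X.1]; norm_num)
          (by rw [hy0', h1X.2])
        have ht'' : t' = 2 := by omega
        subst ht''
        exact h2 ⟨he, hy⟩
  -- GAP TWO: the wall run after `t` and its dive at the odd column `a' = x + b' - 1`
  have hY1 : ω (t + 1) 1 = 0 := (wall_steps_horizontal hp ht1 htn ht2 hYt).1.2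
  have hexQ' : ∃ j, t + j ≤ n ∧ ¬ (ω (t + j) 0 = x + j ∧ ω (t + j) 1 = 0) :=
    ⟨s - t, by omega, fun h => by rw [show t + (s - t) = s by omega] at h; rw [h.2] at hsy; norm_num at hsy⟩
  obtain ⟨hbn', hbQ'⟩ := Nat.find_spec hexQ'
  have hQ' : ∀ j, j < Nat.find hexQ' → ω (t + j) 0 = x + j ∧ ω (t + j) 1 = 0 := fun j hj => by
    have := Nat.find_min hexQ' hj
    push Not at this
    exact this (by omega)
  set b' := Nat.find hexQ' with hb'def
  have hb'2 : 2 ≤ b' := by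
    by_contra hlt
    have h01 : b' = 0 ∨ b' = 1 := by omega
    rcases h01 with h | h <;> rw [h] at hbQ'
    · exact hbQ' ⟨by simp [hxdef], by simpa using hYt⟩
    · exact hbQ' ⟨by rw [hR]; simp, hY1⟩
  have hb's : b' ≤ s - t := by
    by_contra hlt
    have := (hQ' (s - t) (by omega)).1
    rw [show t + (s - t) = s by omega, hsx] at this
    omega
  obtain ⟨hQa0', hQa1'⟩ := hQ' (b' - 1) (by omega)
  obtain ⟨hQp0', hQp1'⟩ := hQ' (b' - 2) (by omega)
  have hadj' := (brickWallGraph_adj_coord _ _).1 (hbw (t + (b' - 1)) (by omega))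
  rw [show t + (b' - 1) + 1 = t + b' by omega] at hadj'
  have hbY' : ω (t + b') 1 = -1 ∧ (ω (t + (b' - 1)) 0) % 2 = 1 := by
    rcases hadj' with ⟨h01 | h01, h11⟩ | ⟨h00, ⟨h1a, -⟩ | ⟨h1a, h1b⟩⟩
    · exfalso; exact hbQ' ⟨by rw [h01, hQa0']; ring_nf; omega, by rw [h11, hQa1']⟩
    · exfalso
      have := hinj' (a := t + b') (b := t + (b' - 2)) hbn' (by omega) (by rw [hQp0']; omega)
        (by rw [h11, hQa1', hQp1'])
      omega
    · exfalso; have := hhp (t + b') hbn'; rw [hQa1'] at h1a; omega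
    · rw [hQa1'] at h1a; rw [h00] at h1b
      exact ⟨by omega, by omega⟩
  obtain ⟨hbY1', hodd'⟩ := hbY'
  have hg₂W : ∀ t' ∈ wallTimes n ω, ω t' 0 ≠ ω (t + (b' - 1)) 0 + 1 :=
    wallTimes_apply_ne_of_dive hp (i := t + (b' - 1)) (by omega) hQa1'
      (by rw [show t + (b' - 1) - 1 = t + (b' - 2) by omega, hQp0', hQa0']; ring_nf; omega)
      (by rw [show t + (b' - 1) + 1 = t + b' by omega, hbY1'])
  set g₂ := ω (t + (b' - 1)) 0 + 1 with hg₂def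
  have hg₂x : x + 2 ≤ g₂ := by rw [hg₂def, hQa0']; omega
  have hg₂L : g₂ ≤ ω n 0 := by
    have := (hb (t + (b' - 1)) (by omega) (by omega)).2
    omega
  have hg₂e : g₂ % 2 = 0 := by omega
  -- COUNT: the visit abscissae, halved, inject into `[1, X_n/2]` minus `{g₁/2, g₂/2}`
  have hmem1 : g₁ / 2 ∈ (Finset.Icc (1 : ℤ) (ω n 0 / 2)).erase (g₂ / 2) := by
    rw [Finset.mem_erase, Finset.mem_Icc]; refine ⟨by omega, by omega, by omega⟩
  have hmem2 : g₂ / 2 ∈ Finset.Icc (1 : ℤ) (ω n 0 / 2) := by rw [Finset.mem_Icc]; constructor <;> omega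
  have h1 : #(wallTimes n ω) ≤ #(((Finset.Icc (1 : ℤ) (ω n 0 / 2)).erase (g₂ / 2)).erase (g₁ / 2)) := by
    refine Finset.card_le_card_of_injOn (fun t' => ω t' 0 / 2) (fun t' ht' => ?_) (fun a ha' b hb'' he => ?_)
    · have ht0 := Finset.mem_coe.1 ht'
      obtain ⟨he, hpos, hle⟩ := hWeven ht0
      rw [Finset.mem_coe, Finset.mem_erase, Finset.mem_erase, Finset.mem_Icc]
      show ω t' 0 / 2 ≠ g₁ / 2 ∧ ω t' 0 / 2 ≠ g₂ / 2 ∧ 1 ≤ ω t' 0 / 2 ∧ ω t' 0 / 2 ≤ ω n 0 / 2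
      exact ⟨fun h => hg₁W t' ht0 (by omega), fun h => hg₂W t' ht0 (by omega), by omega, by omega⟩
    · obtain ⟨he1, -, -⟩ := hWeven (Finset.mem_coe.1 ha')
      obtain ⟨he2, -, -⟩ := hWeven (Finset.mem_coe.1 hb'')
      exact hWinj (Finset.mem_coe.1 ha') (Finset.mem_coe.1 hb'') (by dsimp only at he; omega)
  rw [Finset.card_erase_of_mem hmem1, Finset.card_erase_of_mem hmem2, Int.card_Icc] at h1
  have h3 := Int.toNat_of_nonneg (show (0 : ℤ) ≤ ω n 0 / 2 + 1 - 1 by omega)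
  rw [visits_eq_card]
  omega

/-! ### §3 The counts at slack two (`n = 6k + 2`, `v = k`) -/

open Classical in
/-- **Slack two, numerically.** An irreducible positive wall bridge of length `6k + 2` (`k ≥ 2`) with `k` visits has
span `X ∈ {2k+2, 2k+4}`, `#up = #down ≤ 3`, and `#down ≤ 2` if `X = 2k + 4`; if `X = 2k + 2` its interior
near-renewal visit times all equal `2` (the second gap); there is at most one interior near-renewal visit time, and
exactly one if `#down = 3` or (`X = 2k + 4` and `#down = 2`) (the sharp down-step count). NEW, a-idea-1 lineage
(PROOF-slack2 §1, Corollary D; data FINDING-HEX-WALL-SLACK-TWO-LAW §1).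
[cite: MadrasSlade1993, §4.2, remark before (4.2.21) (p. 94)] -/
theorem slack_two_counts {k m : ℕ} (hk : 2 ≤ k) (hm : m = 6 * k + 2) (hω : ω ∈ ipwb m) (hv : visits m ω = k) :
    (ω m 0 = 2 * k + 2 ∨ ω m 0 = 2 * k + 4) ∧ #(stepsU m ω) = #(stepsD m ω) ∧ #(stepsD m ω) ≤ 3 ∧
      (ω m 0 = 2 * k + 4 → #(stepsD m ω) ≤ 2) ∧
      (ω m 0 = 2 * k + 2 → ∀ t ∈ wallTimes m ω, t < m → NearRenewal m ω t → t = 2) ∧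
      #(((wallTimes m ω).erase m).filter fun t => NearRenewal m ω t) ≤ 1 ∧
      ((#(stepsD m ω) = 3 ∨ (ω m 0 = 2 * k + 4 ∧ #(stepsD m ω) = 2)) →
        #(((wallTimes m ω).erase m).filter fun t => NearRenewal m ω t) = 1) := by
  classical
  have hm4 : 4 ≤ m := by omega
  obtain ⟨hA, hS, hUD⟩ := six_step_sharp hω hm4
  have hF2 := apply_add_four_mul_visits_le hω hm4
  have hF3 := apply_add_card_stepsD_add_four_mul_visits_le hω hm4
  have hpar : ω m 0 % 2 = 0 := by
    obtain ⟨hp, -, -⟩ := mem_ipwb.1 hω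
    obtain ⟨hw, -⟩ := mem_pwb.1 hp
    obtain ⟨ha, -⟩ := mem_wbr.1 hw
    obtain ⟨hh, -, hYn⟩ := mem_archs.1 ha
    obtain ⟨hs, -⟩ := mem_hpw.1 hh
    have := parity_apply hs le_rfl; rw [hYn, add_zero] at this; omega
  rw [hv] at hA hS hF2 hF3
  have hmZ : ((m : ℕ) : ℤ) = 6 * k + 2 := by rw [hm]; push_cast; ring
  set E := ((wallTimes m ω).erase m).filter fun t => NearRenewal m ω t with hEdef
  have hmemW : ∀ {t}, t ∈ wallTimes m ω ↔ (1 ≤ t ∧ t ≤ m) ∧ t % 2 = 0 ∧ ω t 1 = 0 := fun {t} => by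
    rw [wallTimes, Finset.mem_filter, Finset.mem_Icc]
  have hmemE : ∀ {t}, t ∈ E → t ∈ wallTimes m ω ∧ t < m ∧ NearRenewal m ω t ∧ 2 ≤ t ∧ t % 2 = 0 :=
    fun {t} ht => by
    rw [hEdef, Finset.mem_filter, Finset.mem_erase] at ht
    obtain ⟨⟨htm, htW⟩, hnr⟩ := ht
    obtain ⟨⟨ht1, htm'⟩, ht2, -⟩ := hmemW.1 htW
    exact ⟨htW, by omega, hnr, by omega, ht2⟩
  -- the second gap at slack two: a near-renewal at `t ≥ 4` forces `X = 2k + 4`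
  have hG : ∀ t ∈ wallTimes m ω, t < m → NearRenewal m ω t → 4 ≤ t → 2 * (k : ℤ) + 4 ≤ ω m 0 := by
    intro t ht htm hnr h4
    have := two_mul_visits_add_four_le_apply_of_nearRenewal hω ht htm h4 hnr
    rw [hv] at this; exact this
  have hX : ω m 0 = 2 * k + 2 ∨ ω m 0 = 2 * k + 4 := by omega
  -- two distinct interior near-renewal visit times ⇒ one of them is `≥ 4`
  have hE2 : 2 ≤ #E → 2 * (k : ℤ) + 4 ≤ ω m 0 := fun h2 => by
    obtain ⟨a, ha, b, hb, hab⟩ := Finset.one_lt_card.1 (show 1 < #E by omega)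
    obtain ⟨haW, ham, hanr, ha2, hae⟩ := hmemE ha
    obtain ⟨hbW, hbm, hbnr, hb2, hbe⟩ := hmemE hb
    by_cases h4 : 4 ≤ a
    · exact hG a haW ham hanr h4
    · exact hG b hbW hbm hbnr (by omega)
  -- near-renewals pay two down steps each
  have hF5 : 2 * #E ≤ #(stepsD m ω) :=
    two_mul_card_nearRenewal_le_card_stepsD hω fun t ht => let h := hmemE ht; ⟨h.1, h.2.1, h.2.2.1⟩
  have hD3 : #(stepsD m ω) ≤ 3 := by
    by_contra hlt
    have h2 : 2 ≤ #E := by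
      have : (2 : ℤ) ≤ #E := by omega
      exact_mod_cast this
    have := hE2 h2
    omega
  have hE1 : #E ≤ 1 := by
    by_contra hlt
    have := hE2 (by omega)
    omega
  refine ⟨hX, hUD, hD3, fun h => ?_, fun h t ht htm hnr => ?_, hE1, fun h => ?_⟩
  · have : (#(stepsD m ω) : ℤ) ≤ 2 := by omega
    exact_mod_cast this
  · obtain ⟨⟨ht1, -⟩, ht2, -⟩ := hmemW.1 ht
    by_contra hne
    have := hG t ht htm hnr (by omega)
    omega
  · have : (1 : ℤ) ≤ #E := by rcases h with h | ⟨h, h'⟩ <;> omega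
    have h1 : 1 ≤ #E := by exact_mod_cast this
    omega

/-! ### §4 Profile machinery, public (horizontal runs are monotone; heights from the vertical-step counts)

The private run lemmas of `HexSAWSurfaceWallRenewalSixStepRigid` §2, re-proved under public names for the slack-two
classification (this file's §5 and its successor). -/

/-- A step which is neither up nor down is horizontal. [cite: EntingJensen2009, §7.4.2, Fig. 7.10 (brickwork form of the honeycomb lattice)] -/
theorem step_horizontal_of_not_mem (hbw : IsBW n ω) {i : ℕ} (hi : i < n) (hU : i ∉ stepsU n ω)
    (hD : i ∉ stepsD n ω) : ω (i + 1) 1 = ω i 1 ∧ (ω (i + 1) 0 = ω i 0 + 1 ∨ ω (i + 1) 0 = ω i 0 - 1) := by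
  have h := step_cases hbw hi
  simp only [stepsU, stepsD, Finset.mem_filter, Finset.mem_range, not_and] at hU hD
  have hU' := hU hi
  have hD' := hD hi
  omega

/-- The parity constraint of an up step: it starts at a site `(a, b)` with `a + b` even.
[cite: EntingJensen2009, §7.4.2, Fig. 7.10] -/
theorem of_mem_stepsU_coord (hbw : IsBW n ω) {i : ℕ} (hi : i ∈ stepsU n ω) :
    i < n ∧ ω (i + 1) 0 = ω i 0 ∧ ω (i + 1) 1 = ω i 1 + 1 ∧ (ω i 0 + ω i 1) % 2 = 0 := by
  simp only [stepsU, Finset.mem_filter, Finset.mem_range] at hi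
  obtain ⟨hin, hx, hy⟩ := hi
  have h := (brickWallGraph_adj_coord _ _).1 (hbw i hin)
  exact ⟨hin, hx, hy, by omega⟩

/-- The parity constraint of a down step: it ends at a site `(a, b)` with `a + b` even.
[cite: EntingJensen2009, §7.4.2, Fig. 7.10] -/
theorem of_mem_stepsD_coord (hbw : IsBW n ω) {i : ℕ} (hi : i ∈ stepsD n ω) :
    i < n ∧ ω (i + 1) 0 = ω i 0 ∧ ω (i + 1) 1 = ω i 1 - 1 ∧ (ω (i + 1) 0 + ω (i + 1) 1) % 2 = 0 := by
  simp only [stepsD, Finset.mem_filter, Finset.mem_range] at hi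
  obtain ⟨hin, hx, hy⟩ := hi
  have h := (brickWallGraph_adj_coord _ _).1 (hbw i hin)
  exact ⟨hin, hx, hy, by omega⟩

/-- **Horizontal runs are monotone**: on a time interval `[a, b]` without vertical steps a self-avoiding walk moves
with constant velocity `e = ±1` along its row. [cite: MadrasSlade1993, §1.2] -/
theorem run_const_velocity (hinj : Set.InjOn ω {i | i ≤ n}) {a b : ℕ} (hab : a ≤ b) (hbn : b ≤ n)
    (hh : ∀ i, a ≤ i → i < b → ω (i + 1) 1 = ω i 1 ∧ (ω (i + 1) 0 = ω i 0 + 1 ∨ ω (i + 1) 0 = ω i 0 - 1)) :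
    ∃ e : ℤ, (e = 1 ∨ e = -1) ∧ ∀ i, a ≤ i → i ≤ b → ω i 0 = ω a 0 + e * ((i - a : ℕ) : ℤ) ∧ ω i 1 = ω a 1 := by
  rcases Nat.lt_or_ge a b with hlt | hge
  swap
  · refine ⟨1, Or.inl rfl, fun i h1 h2 => ?_⟩
    obtain rfl : i = a := le_antisymm (h2.trans hge) h1
    simp
  obtain ⟨hy0, hx0⟩ := hh a le_rfl hlt
  -- the velocity of the first step
  obtain ⟨e, he, hx0'⟩ : ∃ e : ℤ, (e = 1 ∨ e = -1) ∧ ω (a + 1) 0 = ω a 0 + e := by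
    rcases hx0 with h | h
    · exact ⟨1, Or.inl rfl, h⟩
    · exact ⟨-1, Or.inr rfl, by omega⟩
  refine ⟨e, he, ?_⟩
  -- two consecutive values at a time, by induction on the offset
  have key : ∀ d, a + d + 1 ≤ b →
      (ω (a + d) 0 = ω a 0 + e * (d : ℤ) ∧ ω (a + d) 1 = ω a 1) ∧
        (ω (a + d + 1) 0 = ω a 0 + e * ((d : ℤ) + 1) ∧ ω (a + d + 1) 1 = ω a 1) := by
    intro d
    induction d with
    | zero =>
      intro _
      refine ⟨⟨by simp, by simp⟩, by simpa using hx0', by simpa using hy0⟩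
    | succ d ih =>
      intro hd
      obtain ⟨⟨hx1, hy1⟩, hx2, hy2⟩ := ih (by omega)
      refine ⟨⟨by rw [show a + (d + 1) = a + d + 1 by omega, hx2]; push_cast; ring, by
        rw [show a + (d + 1) = a + d + 1 by omega, hy2]⟩, ?_⟩
      obtain ⟨hy3, hx3⟩ := hh (a + d + 1) (by omega) (by omega)
      rw [show a + (d + 1) + 1 = a + d + 1 + 1 by omega]
      refine ⟨?_, by rw [hy3, hy2]⟩
      -- a reversal would revisit `ω (a + d)`
      by_contra hne
      have hback : ω (a + d + 1 + 1) 0 = ω (a + d) 0 := by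
        rcases he with rfl | rfl <;> rcases hx3 with h | h <;> omega
      have := hinj (show a + d + 1 + 1 ∈ {i | i ≤ n} by simp; omega) (show a + d ∈ {i | i ≤ n} by simp; omega)
        (site_ext_gap hback (by rw [hy3, hy2, hy1]))
      omega
  intro i h1 h2
  rcases Nat.lt_or_ge i b with hib | hib
  · obtain ⟨⟨hx, hy⟩, -⟩ := key (i - a) (by omega)
    rw [show a + (i - a) = i by omega] at hx hy
    exact ⟨hx, hy⟩
  · obtain rfl : i = b := le_antisymm h2 hib
    obtain ⟨-, hx, hy⟩ := key (i - a - 1) (by omega)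
    rw [show a + (i - a - 1) + 1 = i by omega] at hx hy
    refine ⟨?_, hy⟩
    rw [hx, show ((i - a : ℕ) : ℤ) = ((i - a - 1 : ℕ) : ℤ) + 1 by omega]

/-- The height at time `t` is the number of up steps minus the number of down steps before `t`.
[cite: MadrasSlade1993, §1.2 (coordinates of a walk as sums of steps)] -/
theorem apply_one_eq_card_stepsU_sub_card_stepsD (hbw : IsBW n ω) (hY0 : ω 0 1 = 0) {t : ℕ} (ht : t ≤ n) :
    ω t 1 = #((stepsU n ω).filter (· < t)) - #((stepsD n ω).filter (· < t)) := by
  have hbw' : IsBW t ω := fun i hi => hbw i (by omega)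
  obtain ⟨-, -, hY⟩ := steps_count hbw'
  rw [hY0, sub_zero] at hY
  have hU : stepsU t ω = (stepsU n ω).filter (· < t) := by
    ext i
    simp only [stepsU, Finset.mem_filter, Finset.mem_range]
    constructor
    · rintro ⟨h1, h2⟩; exact ⟨⟨by omega, h2⟩, h1⟩
    · rintro ⟨⟨-, h2⟩, h3⟩; exact ⟨h3, h2⟩
  have hD : stepsD t ω = (stepsD n ω).filter (· < t) := by
    ext i
    simp only [stepsD, Finset.mem_filter, Finset.mem_range]
    constructor
    · rintro ⟨h1, h2⟩; exact ⟨⟨by omega, h2⟩, h1⟩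
    · rintro ⟨⟨-, h2⟩, h3⟩; exact ⟨h3, h2⟩
  rw [← hU, ← hD]
  exact hY

/-- Counting a singleton below a threshold. [folklore] -/
private theorem card_singleton_filter_lt (x t : ℕ) :
    (#(({x} : Finset ℕ).filter (· < t)) : ℤ) = if x < t then 1 else 0 := by
  rw [Finset.filter_singleton]
  split_ifs <;> simp

/-- A wall-renewal time from the profile data: `t` even on the wall, no earlier column beyond `X_t`, every later
column beyond it. [cite: MadrasSlade1993, §4.2, Definition 4.2.1] -/
theorem isWRen_of_profile (hb : ∀ i, 1 ≤ i → i ≤ n → ω 0 0 < ω i 0 ∧ ω i 0 ≤ ω n 0) {t : ℕ} (htn : t ≤ n)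
    (ht2 : t % 2 = 0) (hY : ω t 1 = 0) (hhead : ∀ i, 1 ≤ i → i ≤ t → ω i 0 ≤ ω t 0)
    (htail : ∀ j, t < j → j ≤ n → ω t 0 < ω j 0) : IsWRen n ω t := by
  refine ⟨⟨htn, fun i h1 h2 => ⟨(hb i h1 (h2.trans htn)).1, hhead i h1 h2⟩, fun j h1 h2 => ⟨?_, ?_⟩⟩, ht2, hY⟩
  · simpa only [Nat.add_zero] using htail (t + j) (by omega) (by omega)
  · have := (hb (t + j) (by omega) (by omega)).2
    show ω (t + j) 0 ≤ ω (t + (n - t)) 0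
    rwa [show t + (n - t) = n by omega]

/-- On a stretch along the wall the visits are the even times: `visits m = ⌊m/2⌋`.
[cite: BeatonBousquetMelouDeGierDuminilCopinGuttmann2014, §3.1 (arXiv v5 p. 8)] -/
theorem visits_eq_div_two_of_wall {m : ℕ} {ξ : ℕ → Site 2} (h : ∀ i, 1 ≤ i → i ≤ m → ξ i 1 = 0) :
    visits m ξ = m / 2 := by
  induction m with
  | zero => simp
  | succ m ih =>
    rw [visits_succ, ih (fun i h1 h2 => h i h1 (by omega)), h (m + 1) (by omega) le_rfl]
    split_ifs with hc <;> omega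

/-- The first step of a positive wall bridge is the wall step `(0,0) → (1,0)`. [cite: MadrasSlade1993, Definition 1.2.4] -/
theorem first_step_eq (hbw : IsBW n ω) (hn : 1 ≤ n) (hX0 : ω 0 0 = 0) (hY0 : ω 0 1 = 0)
    (hb : ∀ i, 1 ≤ i → i ≤ n → ω 0 0 < ω i 0 ∧ ω i 0 ≤ ω n 0) : ω 1 0 = 1 ∧ ω 1 1 = 0 := by
  have h := step_cases hbw (show 0 < n by omega)
  simp only [Nat.zero_add] at h
  have h1 := (hb 1 le_rfl hn).1
  omega

/-! ### §5 The profile `D U` and the lower bound `#down ≥ 2` at slack two -/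

/-- **Profile `D U`** (`#down = #up = 1`): the three horizontal runs all go right (a left run on row `−1` would climb
back onto the initial wall run, a left final run would end left of an earlier column), so `X_n = n − 2`. (Public form of
the first profile lemma of `HexSAWSurfaceWallRenewalSixStepRigid`, without its equality-case hypothesis.)
[cite: MadrasSlade1993, §4.2, Definition 4.2.1] -/
theorem apply_eq_sub_two_of_card_stepsD_eq_one (hω : ω ∈ ipwb n) (hD : #(stepsD n ω) = 1)
    (hU : #(stepsU n ω) = 1) : ω n 0 = n - 2 := by
  classical
  obtain ⟨hp, hn1, -⟩ := mem_ipwb.1 hω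
  obtain ⟨hw, hb⟩ := mem_pwb.1 hp
  obtain ⟨ha, -⟩ := mem_wbr.1 hw
  obtain ⟨hh, -, -⟩ := mem_archs.1 ha
  obtain ⟨hs, hhp⟩ := mem_hpw.1 hh
  obtain ⟨h0, -, hbw, hinj⟩ := mem_saws_iff.1 hs
  have hX0 : ω 0 0 = 0 := by rw [h0]; rfl
  have hY0 : ω 0 1 = 0 := by rw [h0]; rfl
  have hb' : ∀ i, 1 ≤ i → i ≤ n → 0 < ω i 0 ∧ ω i 0 ≤ ω n 0 := fun i h1 h2 => by
    have := hb i h1 h2; rwa [hX0] at this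
  obtain ⟨p, hDp⟩ := Finset.card_eq_one.1 hD
  obtain ⟨r, hUr⟩ := Finset.card_eq_one.1 hU
  obtain ⟨hpn, hpx, hpy, -⟩ := of_mem_stepsD_coord hbw (show p ∈ stepsD n ω by rw [hDp]; exact Finset.mem_singleton_self _)
  obtain ⟨hrn, hrx, hry, -⟩ := of_mem_stepsU_coord hbw (show r ∈ stepsU n ω by rw [hUr]; exact Finset.mem_singleton_self _)
  have hhor : ∀ i, i < n → i ≠ p → i ≠ r →
      ω (i + 1) 1 = ω i 1 ∧ (ω (i + 1) 0 = ω i 0 + 1 ∨ ω (i + 1) 0 = ω i 0 - 1) := fun i hi hip hir =>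
    step_horizontal_of_not_mem hbw hi (by rw [hUr, Finset.mem_singleton]; exact hir)
      (by rw [hDp, Finset.mem_singleton]; exact hip)
  have hYt : ∀ t, t ≤ n → ω t 1 = (if r < t then 1 else 0) - (if p < t then 1 else 0) := fun t ht => by
    rw [apply_one_eq_card_stepsU_sub_card_stepsD hbw hY0 ht, hUr, hDp, card_singleton_filter_lt, card_singleton_filter_lt]
  -- the down step comes first
  have hpr : p < r := by
    have h1 := hYt (r + 1) (by omega)
    have h2 := hhp (r + 1) (by omega)
    have hne : p ≠ r := fun h => by rw [h] at hpy; omega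
    split_ifs at h1 <;> omega
  -- run 0: the wall run `(i, 0)`, `i ≤ p`
  have h10 := first_step_eq hbw hn1 hX0 hY0 hb
  have hp1 : 1 ≤ p := by
    by_contra h
    obtain rfl : p = 0 := by omega
    norm_num at hpx
    have := (hb' 1 le_rfl hn1).1
    omega
  obtain ⟨e0, he0, hrun0⟩ := run_const_velocity hinj (a := 0) (b := p) (by omega) (by omega)
    (fun i h1 h2 => hhor i (by omega) (by omega) (by omega))
  have he0' : e0 = 1 := by
    have := (hrun0 1 (by omega) hp1).1
    rcases he0 with rfl | rfl <;> omega
  subst he0'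
  have hYp : ω p 1 = 0 := by rw [(hrun0 p (by omega) le_rfl).2, hY0]
  -- run 1 on row `−1` from `(p, −1)`; it must go right, else the up step lands on the wall run
  obtain ⟨e1, he1, hrun1⟩ := run_const_velocity hinj (a := p + 1) (b := r) (by omega) (by omega)
    (fun i h1 h2 => hhor i (by omega) (by omega) (by omega))
  have hx : (p : ℤ) + 1 ≤ ω r 0 := by
    by_contra hlt
    have hr1 := (hb' r (by omega) (by omega)).1
    -- the wall site `(X_r, 0) = ω (r+1)` is the site of the wall run at time `X_r ≤ p`
    have hτ := hrun0 (ω r 0).toNat (by omega) (by omega)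
    have := hinj (show r + 1 ∈ {i | i ≤ n} by simp; omega) (show (ω r 0).toNat ∈ {i | i ≤ n} by simp; omega)
      (site_ext_gap (by rw [hrx, hτ.1, hX0]; omega) (by rw [hry, (hrun1 r (by omega) le_rfl).2, hpy, hτ.2, hY0, hYp]; omega))
    omega
  have hxr : ω r 0 = (r : ℤ) - 1 := by
    have := (hrun1 r (by omega) le_rfl).1
    rw [hpx, (hrun0 p (by omega) le_rfl).1, hX0] at this
    rcases he1 with rfl | rfl <;> omega
  -- run 2 on the wall from `(r − 1, 0)`: it goes right (the endpoint is the rightmost point)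
  obtain ⟨e2, he2, hrun2⟩ := run_const_velocity hinj (a := r + 1) (b := n) (by omega) le_rfl
    (fun i h1 h2 => hhor i (by omega) (by omega) (by omega))
  have h1 := (hrun2 n (by omega) le_rfl).1
  have h2 := (hb' (r + 1) (by omega) (by omega)).2
  rw [hrx] at h1 h2
  rcases he2 with rfl | rfl <;> omega

/-- **At slack two there are at least two down steps**: the profile `D U` has `X_n = n − 2 = 6k`, which exceeds the
span bound `X_n ≤ 2k + 4` for `k ≥ 2`. With `slack_two_counts`: `#down = #up ∈ {2, 3}`. NEW, a-idea-1 lineage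
(PROOF-slack2 §3). [cite: MadrasSlade1993, §4.2, remark before (4.2.21) (p. 94)] -/
theorem two_le_card_stepsD_of_slack_two {k m : ℕ} (hk : 2 ≤ k) (hm : m = 6 * k + 2) (hω : ω ∈ ipwb m)
    (hv : visits m ω = k) : 2 ≤ #(stepsD m ω) := by
  have hm4 : 4 ≤ m := by omega
  have hF2 := apply_add_four_mul_visits_le hω hm4
  have hUD := card_stepsU_eq_card_stepsD hω hm4
  have hD1 := one_le_card_stepsD hω hm4
  rw [hv] at hF2
  by_contra hlt
  have hD : #(stepsD m ω) = 1 := by omega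
  have hX := apply_eq_sub_two_of_card_stepsD_eq_one hω hD (by rw [hUD, hD])
  have hmZ : ((m : ℕ) : ℤ) = 6 * k + 2 := by rw [hm]; push_cast; ring
  rw [hmZ] at hX hF2
  omega


end Literature.Probability.RandomPlanarGeometry.SAW.HexBW.Wall
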